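import Summits.Ventures.HSemireg.WedgeHankelBoxSiegel
import Summits.Ventures.HSemireg.WedgeHankelSiegelIdealKernel
import Summits.Ventures.HSemireg.WedgeWeilSpan

/-!
# Venture HSemireg — THE BOX SIEGEL IDEAL (1/2): the ideal of `⋀(K^{Σ 2m_i})` generated by the Siegel spaces of ALL factors of a
# Hankel box, in EVERY degree — killed by every Hankel box; its factorwise building blocks and the product inclusions

HONEST FRAMING. Part of the Lean index of the computation cell `pub-hsemireg` (seat p10 gen 12, Sunday typer «UNIFORM-IN-n»).
Finite-dimensional EXTERIOR ALGEBRA over a field ONLY: no variety, no cohomology theory, no sheaf, no Ext group and no semiregularity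
map is constructed here; nothing here says that HC / HC_CM / HC_AV holds; no Literature fact is declared or used.  Custodian versions
cited: theory/FORMULA-N.md PART A §2.3 THEOREM K («rank polynomials MULTIPLY»), §2.6 THEOREM H / FN-4 (i) («with v-independent kernel the
Θ-isotropic part»); STRUCTURE.md v1.0-SIGNED 9b196a05977dd067 §1.1 C15 / Σ2.  The dictionary (`s^{(i)}_{ab} ↔ ∂_a ∧ dz̄_b + ∂_b ∧ dz̄_a` on the
factor `X_i`; `⌟(v₀ ⊠ ⋯ ⊠ v_{n−1})` on `HT^k(X₀ × ⋯ × X_{n−1})` ↦ `θ ↦ θ ∧ (v₀ ∧ ⋯ ∧ v_{n−1})` on `⋀^k K^{Σ 2m_i}`) is QUOTED, never asserted.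

WHAT IS IN THE TREE / KEYED.  One factor (p10 g11, `WedgeHankelSiegelIdeal*`, rows 643/654/662): the degree-`k` Siegel ideal `SI_k ⊆ ⋀^k K^{2m}`,
its complement spanned by the standard monomials `x_{S∖A} y_A` (`repSpan`), `dim SI_k + (k+1)·C(m,k) = C(2m,k)`.  Boxes (p10 g10, rows 585/629):
the Hankel box `F = v₀ ∧ ⋯ ∧ v_{n−1}` on gen 6's mixed model `Σₗ i, Fin (m_i + m_i)` and its DEGREE-2 product Siegel space `SiegelBox ≤ ker(θ ↦ θ ∧ F ∣ ⋀²)`;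
«higher degrees NOT typed».  THIS FILE and its sequel (`WedgeHankelBoxSiegelIdealKernel`) type the product Siegel ideal in EVERY degree:
* §1 generic bookkeeping (any generator type): **`finrank_mul_le`** (`dim (M ∧ N) ≤ dim M · dim N`), **`finrank_biSup_le_sum`**, `finrank_Hom`
  (`dim Hom(D, d) = C(|D|, d)`), and the KÜNNETH SPLITTING in inclusion form **`Hom_union_le`: `Hom(D₁ ∪ D₂, k) ≤ Σ_{a+b=k} Hom(D₁, a) ∧ Hom(D₂, b)`**.
* §2 the factorwise building blocks inside the box algebra: the STANDARD part `R_i^b := emb_i(span{x_{S∖A} y_A})` and the SIEGEL part `S_i^b :=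
  emb_i(SI_b)` of factor `i` in degree `b`; **`R_sup_S` / `R_inf_S`: `Hom(block i, b) = R_i^b ⊕ S_i^b`**, **`finrank_R`: `dim R_i^b = (b+1)·C(m_i, b)`**,
  **`finrank_S`: `dim S_i^b + (b+1)·C(m_i,b) = C(2m_i, b)`** (one-factor theorems transported along the injective block embedding); prefix blocks `pre j`.
* §3 **THE BOX SIEGEL IDEAL** `boxSI j k := span{E_t ∧ emb_i(s^{(i)}_{ab}) : t ⊆ pre j, |t| + 2 = k, i < j}` (degree-`k` part of the ideal generated by the
  Siegel spaces of the first `j` factors on the first `j` blocks) and **`boxSiegelIdeal m k := boxSI n k`** (all factors; `boxSiegelIdeal_two` = gen 10's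
  `siegelBox`); **`mul_hankelBox_eq_zero_of_mem_boxSI` / `boxSiegelIdeal_le_ker`: THE BOX SIEGEL IDEAL IS KILLED BY EVERY HANKEL BOX, in every degree,
  for EVERY factor classes `q_i`** — a named `q`-independent part of `ker(θ ↦ θ ∧ F ∣ ⋀^k)`; `finrank_boxSiegelIdeal_le_finrank_ker`.
* §4 the PRODUCT INCLUSIONS driving the sequel's induction on the number of factors: **`boxSI_mul_Hom_le`: `boxSI_j^a ∧ Hom(block j, b) ≤ boxSI_{j+1}^{a+b}`**
  (embedded Siegel 2-vectors are even, hence central up to nothing) and **`Hom_mul_S_le`: `Hom(pre j, a) ∧ S_j^b ≤ boxSI_{j+1}^{a+b}`**.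
The sequel proves `dim boxSI_n^k + [t^k] Π_i G_{m_i}(t) = C(Σ_i 2m_i, k)`, `G_m(t) = Σ_b (b+1)·C(m,b)·t^b`, a complement spanned by products of the factors'
standard monomials, and the EXCESS LAW for boxes.  NOT typed here: the common kernel `⋂_q ker = boxSI` beyond degree 2 (needs a factorwise stabilisation);
anything Ext-side.  Class side only.  Sign-free throughout (structure constants are units, never evaluated).
Namespace `Summit.Ventures.HSemireg.Wedge.HankelBoxSiegelIdeal` (new); new names only.
-/

open Module

namespace Summit.Ventures.HSemireg.Wedge.HankelBoxSiegelIdeal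

open Summit.Ventures.HSemireg.Wedge Summit.Ventures.HSemireg.Wedge.Kunneth Summit.Ventures.HSemireg.Wedge.MixedBox
  Summit.Ventures.HSemireg.Wedge.HankelSiegel Summit.Ventures.HSemireg.Wedge.HankelSiegelIdeal
  Summit.Ventures.HSemireg.Wedge.HankelBox

variable (K : Type*) [Field K]

/-! ## §1. Generic bookkeeping: products and sums of subspaces; homogeneous pieces of a union of two blocks -/

section Generic

variable {I : Type*} [LinearOrder I] [Fintype I]

/-- a subspace is the span of (the images of) the vectors of a basis of it. -/
lemma span_range_finBasis (M : Submodule K (HT K I)) :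
    Submodule.span K (Set.range fun i => ((Module.finBasis K M) i : HT K I)) = M := by
  have h : (fun i => ((Module.finBasis K M) i : HT K I)) = M.subtype ∘ (Module.finBasis K M) := rfl
  rw [h, Set.range_comp, Submodule.span_image, (Module.finBasis K M).span_eq, Submodule.map_top, Submodule.range_subtype]

/-- **`dim (M ∧ N) ≤ dim M · dim N`** for subspaces of the exterior algebra: the pairwise products of two bases span `M ∧ N`. -/
theorem finrank_mul_le (M N : Submodule K (HT K I)) : finrank K ↥(M * N) ≤ finrank K M * finrank K N := by
  let v : Fin (finrank K M) × Fin (finrank K N) → HT K I :=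
    fun p => ((Module.finBasis K M) p.1 : HT K I) * ((Module.finBasis K N) p.2 : HT K I)
  have hMN : M * N ≤ Submodule.span K (Set.range v) := by
    have h : M * N = Submodule.span K (Set.range fun i => ((Module.finBasis K M) i : HT K I)) *
        Submodule.span K (Set.range fun i => ((Module.finBasis K N) i : HT K I)) := by
      rw [span_range_finBasis, span_range_finBasis]
    rw [h, Submodule.span_mul_span, Submodule.span_le]
    rintro _ ⟨_, ⟨i, rfl⟩, _, ⟨j, rfl⟩, rfl⟩
    exact Submodule.subset_span ⟨(i, j), rfl⟩
  calc finrank K ↥(M * N) ≤ finrank K (Submodule.span K (Set.range v)) := Submodule.finrank_mono hMN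
    _ ≤ Fintype.card (Fin (finrank K M) × Fin (finrank K N)) := finrank_range_le_card v
    _ = finrank K M * finrank K N := by rw [Fintype.card_prod, Fintype.card_fin, Fintype.card_fin]

/-- **`dim (Σ_{a ∈ s} X a) ≤ Σ_{a ∈ s} dim X a`.** -/
theorem finrank_biSup_le_sum {ι : Type*} (s : Finset ι) (X : ι → Submodule K (HT K I)) :
    finrank K ↥(⨆ a ∈ s, X a) ≤ ∑ a ∈ s, finrank K (X a) := by
  classical
  induction s using Finset.induction_on with
  | empty => simp
  | insert a s has ih =>
    rw [Finset.iSup_insert, Finset.sum_insert has]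
    exact (Submodule.finrank_add_le_finrank_add_finrank _ _).trans (Nat.add_le_add_left ih _)

/-- `dim Hom(D, d) = C(|D|, d)` (the degree-`d` monomials on `D` are a basis; any generator type). -/
lemma finrank_Hom (D : Finset I) (d : ℕ) : finrank K ↥(Hom K I D d) = D.card.choose d := by
  classical
  rw [Weil.Hom_eq_Sp, Weil.finrank_Sp]
  have h : Finset.univ.filter (fun s : Finset I => s ⊆ D ∧ s.card = d) = D.powersetCard d := by
    ext s
    simp [Finset.mem_powersetCard]
  rw [h, Finset.card_powersetCard]

/-- `⋀^k = Hom(univ, k)` (any generator type; cf. `Hankel.exteriorPower_eq_Hom_univ` on `Fin (n+n)`). -/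
lemma exteriorPower_eq_Hom_univ_gen (k : ℕ) :
    (⋀[K]^k (I → K) : Submodule K (HT K I)) = Hom K I Finset.univ k := by
  rw [exteriorPower_eq_span, Hom]
  congr 1
  ext x
  simp

/-- **KÜNNETH SPLITTING, inclusion form: `Hom(D₁ ∪ D₂, k) ≤ Σ_{a+b=k} Hom(D₁, a) ∧ Hom(D₂, b)`** — a degree-`k` monomial on `D₁ ∪ D₂` is, up to
a unit, the product of its `D₁`-part and its part outside `D₁` (no disjointness needed for this direction). -/
theorem Hom_union_le (D₁ D₂ : Finset I) (k : ℕ) :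
    Hom K I (D₁ ∪ D₂) k ≤ ⨆ a ∈ Finset.range (k + 1), Hom K I D₁ a * Hom K I D₂ (k - a) := by
  classical
  rw [Hom, Submodule.span_le]
  rintro _ ⟨t, ⟨ht, hk⟩, rfl⟩
  have hdisj : Disjoint (t ∩ D₁) (t \ D₁) := by
    rw [Finset.disjoint_left]; intro x hx hx'; exact (Finset.mem_sdiff.mp hx').2 (Finset.mem_inter.mp hx).2
  have htu : t ∩ D₁ ∪ t \ D₁ = t := by rw [Finset.union_comm, Finset.sdiff_union_inter]
  have h₂ : t \ D₁ ⊆ D₂ := fun x hx => by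
    rw [Finset.mem_sdiff] at hx; exact (Finset.mem_union.mp (ht hx.1)).resolve_left hx.2
  have hcard : (t \ D₁).card = k - (t ∩ D₁).card := by
    have := Finset.card_union_of_disjoint hdisj; rw [htu] at this; omega
  have ha : (t ∩ D₁).card < k + 1 := by
    have := Finset.card_le_card (Finset.inter_subset_left : t ∩ D₁ ⊆ t); omega
  have hB : B K I t = (u K (t ∩ D₁) (t \ D₁))⁻¹ • (B K I (t ∩ D₁) * B K I (t \ D₁)) := by
    rw [B_mul_B, smul_smul, inv_mul_cancel₀ ((u_ne_zero_iff K).mpr hdisj), one_smul, htu]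
  show B K I t ∈ _
  rw [hB]
  exact Submodule.smul_mem _ _ (Submodule.mem_iSup_of_mem (t ∩ D₁).card
    (Submodule.mem_iSup_of_mem (Finset.mem_range.mpr ha) (Submodule.mul_mem_mul
      (B_mem_Hom K Finset.inter_subset_right rfl) (B_mem_Hom K h₂ hcard))))

omit [Fintype I] in
/-- `|s ∪ t| = |s| + |t|` for disjoint supports, with the union spelled through the linear order (as in `B_mul_B`; this is the spelling the
rewrites below meet — the `Σₗ` generator type of the box model has a second `DecidableEq` instance path). -/
lemma card_union_of_disjoint' {s t : Finset I} (h : Disjoint s t) : (s ∪ t).card = s.card + t.card :=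
  Finset.card_union_of_disjoint h

omit [Fintype I] in
/-- `s ∪ t ⊆ D ∪ D'` from `s ⊆ D`, `t ⊆ D'` (same spelling remark). -/
lemma union_subset_union' {s t D D' : Finset I} (hs : s ⊆ D) (ht : t ⊆ D') : s ∪ t ⊆ D ∪ D' :=
  Finset.union_subset_union hs ht

/-- products of homogeneous pieces of two disjoint blocks are homogeneous on the union (submodule form of `Kunneth.mul_mem_Hom`). -/
lemma Hom_mul_Hom_le {D₁ D₂ : Finset I} (hD : Disjoint D₁ D₂) (a b : ℕ) :
    Hom K I D₁ a * Hom K I D₂ b ≤ Hom K I (D₁ ∪ D₂) (a + b) :=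
  Submodule.mul_le.mpr fun _ hf _ hg => Kunneth.mul_mem_Hom K hD hf hg

end Generic

/-! ## §2. The factorwise building blocks inside the box algebra -/

section Box

variable {n : ℕ} (m : Fin n → ℕ)

/-- block `i`, spelled with a `Fin n` index. -/
lemma blk_fin (i : Fin n) : blk m i = Finset.univ.map (facEmb m i).toEmbedding := by
  rw [blk, dif_pos i.2]

/-- the block embedding of factor `i` carries `Hom(univ, d)` of the factor ONTO `Hom(block i, d)`. -/
lemma map_emb_Hom_univ (i : Fin n) (d : ℕ) :
    (Hom K (Hankel.In (m i)) Finset.univ d).map (emb K (facEmb m i)).toLinearMap = Hom K (Gen m) (blk m i) d := by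
  rw [blk_fin]
  apply le_antisymm
  · rw [Submodule.map_le_iff_le_comap]
    intro θ hθ
    exact emb_mem_Hom K (facEmb m i) hθ
  · rw [Hom, Submodule.span_le]
    rintro _ ⟨t, ⟨ht, hc⟩, rfl⟩
    obtain ⟨s, -, rfl⟩ := Finset.subset_map_iff.mp ht
    refine ⟨B K (Hankel.In (m i)) s, B_mem_Hom K (Finset.subset_univ s) (by rwa [Finset.card_map] at hc), ?_⟩
    rw [AlgHom.toLinearMap_apply, emb_B]

/-- the STANDARD PART of factor `i` in degree `b`: the embedded span of the one-factor standard monomials `x_{S∖A} ∧ y_A`. -/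
noncomputable def R (i : Fin n) (b : ℕ) : Submodule K (HT K (Gen m)) :=
  (repSpan K (m i) b).map (emb K (facEmb m i)).toLinearMap

/-- the SIEGEL PART of factor `i` in degree `b`: the embedded one-factor Siegel ideal `emb_i(SI_b)`. -/
noncomputable def S (i : Fin n) (b : ℕ) : Submodule K (HT K (Gen m)) :=
  (siegelIdeal K (m i) b).map (emb K (facEmb m i)).toLinearMap

/-- **`R_i^b ⊔ S_i^b = Hom(block i, b)`** (the one-factor decomposition `span{x_{S∖A} y_A} ⊔ SI_b = ⋀^b`, transported). -/
theorem R_sup_S (i : Fin n) (b : ℕ) : R K m i b ⊔ S K m i b = Hom K (Gen m) (blk m i) b := by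
  rw [R, S, ← Submodule.map_sup, repSpan_sup_siegelIdeal, Hankel.exteriorPower_eq_Hom_univ, map_emb_Hom_univ]

/-- **`R_i^b ⊓ S_i^b = 0`** (the block embedding is injective). -/
theorem R_inf_S (i : Fin n) (b : ℕ) : R K m i b ⊓ S K m i b = ⊥ := by
  rw [R, S, ← Submodule.map_inf _ (emb_injective K (facEmb m i)), repSpan_inf_siegelIdeal, Submodule.map_bot]

/-- the standard part lies in `Hom(block i, b)`. -/
lemma R_le_Hom (i : Fin n) (b : ℕ) : R K m i b ≤ Hom K (Gen m) (blk m i) b := by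
  rw [← R_sup_S]; exact le_sup_left

/-- the Siegel part lies in `Hom(block i, b)`. -/
lemma S_le_Hom (i : Fin n) (b : ℕ) : S K m i b ≤ Hom K (Gen m) (blk m i) b := by
  rw [← R_sup_S]; exact le_sup_right

/-- **`dim R_i^b = (b+1)·C(m_i, b)`** (the number of standard monomials of degree `b` of factor `i`). -/
theorem finrank_R (i : Fin n) (b : ℕ) : finrank K (R K m i b) = (b + 1) * (m i).choose b := by
  rw [R, ← (Submodule.equivMapOfInjective _ (emb_injective K (facEmb m i)) _).finrank_eq, finrank_repSpan]

/-- **`dim S_i^b + (b+1)·C(m_i, b) = C(2m_i, b)`** (the dimension of the one-factor Siegel ideal, transported). -/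
theorem finrank_S (i : Fin n) (b : ℕ) : finrank K (S K m i b) + (b + 1) * (m i).choose b = (m i + m i).choose b := by
  rw [S, ← (Submodule.equivMapOfInjective _ (emb_injective K (facEmb m i)) _).finrank_eq, finrank_siegelIdeal]

/-! ### the prefix blocks `pre j = block 0 ∪ ⋯ ∪ block (j−1)` -/

/-- the union of the first `j` blocks. -/
def pre (j : ℕ) : Finset (Gen m) := (Finset.range j).biUnion (blk m)

/-- no blocks. -/
lemma pre_zero : pre m 0 = ∅ := by
  rw [pre, Finset.range_zero, Finset.biUnion_empty]

/-- one more block. -/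
lemma pre_succ (j : ℕ) : pre m (j + 1) = pre m j ∪ blk m j := biUnion_range_succ (blk m) j

/-- the first `j` blocks are disjoint from block `j`. -/
lemma disjoint_pre_blk {j : ℕ} (hj : j < n) : Disjoint (pre m j) (blk m j) := disjoint_biUnion_range (blk_disjoint m) hj

/-- all `n` blocks are all generators. -/
lemma pre_top : pre m n = Finset.univ := by
  ext x
  simp only [pre, Finset.mem_univ, Finset.mem_biUnion, Finset.mem_range, iff_true]
  exact ⟨(ofLex x).1, (ofLex x).1.2, (mem_blk m (ofLex x).1.2).mpr rfl⟩

/-- block `j` has `2 m_j` generators. -/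
lemma card_blk {j : ℕ} (hj : j < n) : (blk m j).card = m ⟨j, hj⟩ + m ⟨j, hj⟩ := by
  rw [blk, dif_pos hj, Finset.card_map, Finset.card_univ, Fintype.card_fin]

/-- `|pre (j+1)| = |pre j| + 2 m_j`. -/
lemma card_pre_succ {j : ℕ} (hj : j < n) : (pre m (j + 1)).card = (pre m j).card + (m ⟨j, hj⟩ + m ⟨j, hj⟩) := by
  rw [pre_succ, Finset.card_union_of_disjoint (disjoint_pre_blk m hj), card_blk m hj]

/-- an earlier block lies in the prefix. -/
lemma blk_subset_pre {i j : ℕ} (hij : i < j) : blk m i ⊆ pre m j :=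
  Finset.subset_biUnion_of_mem (blk m) (Finset.mem_range.mpr hij)

/-- the prefix is monotone. -/
lemma pre_mono {i j : ℕ} (hij : i ≤ j) : pre m i ⊆ pre m j :=
  Finset.biUnion_subset_biUnion_of_subset_left (blk m) (Finset.range_mono hij)

/-! ### the embedded Siegel 2-vectors `emb_i(s^{(i)}_{ab})` (gen 10's `bsgen`) -/

/-- every embedded Siegel 2-vector is homogeneous of degree `2` on its block. -/
lemma bsgen_mem_Hom (x : Σ i : Fin n, SIdx (m i)) : bsgen K m x ∈ Hom K (Gen m) (blk m x.1) 2 := by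
  rw [blk_fin]
  exact emb_mem_Hom K _ (sv_mem_Hom_two K _ _)

/-- monomials commute with the (even) embedded Siegel 2-vectors. -/
lemma B_mul_bsgen_comm (s : Finset (Gen m)) (x : Σ i : Fin n, SIdx (m i)) :
    B K (Gen m) s * bsgen K m x = bsgen K m x * B K (Gen m) s :=
  (even_mul_comm K (bsgen_mem_Hom K m x) (B_mem_Hom K (subset_refl s) rfl)).symm

/-- a block-`j` monomial times a block-`j` Siegel 2-vector lies in the Siegel part `S_j` (it is `emb_j(E_s ∧ s_{ab})`). -/
lemma B_mul_bsgen_mem_S {j : ℕ} (hj : j < n) {s : Finset (Gen m)} (hs : s ⊆ blk m j) (p : SIdx (m ⟨j, hj⟩)) :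
    B K (Gen m) s * bsgen K m ⟨⟨j, hj⟩, p⟩ ∈ S K m ⟨j, hj⟩ (s.card + 2) := by
  rw [blk, dif_pos hj] at hs
  obtain ⟨s₀, -, rfl⟩ := Finset.subset_map_iff.mp hs
  refine ⟨igen K (⟨s₀, by rw [Finset.card_map]⟩, p), Submodule.subset_span ⟨_, rfl⟩, ?_⟩
  rw [AlgHom.toLinearMap_apply, igen, map_mul, emb_B]
  rfl

/-! ## §3. The box Siegel ideal -/

/-- generators of the degree-`k` box Siegel ideal of the first `j` factors: `E_t ∧ emb_i(s^{(i)}_{ab})`, `t ⊆ pre j`, `|t| + 2 = k`, `i < j`. -/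
def bgen (j k : ℕ) : Set (HT K (Gen m)) :=
  (fun p : Finset (Gen m) × (Σ i : Fin n, SIdx (m i)) => B K (Gen m) p.1 * bsgen K m p.2) ''
    {p | p.1 ⊆ pre m j ∧ p.1.card + 2 = k ∧ ((p.2.1 : Fin n) : ℕ) < j}

/-- **THE BOX SIEGEL IDEAL of the first `j` factors in degree `k`**: the degree-`k` part of the ideal generated by the Siegel spaces of the
factors `i < j` inside the sub-exterior-algebra of the first `j` blocks. -/
noncomputable def boxSI (j k : ℕ) : Submodule K (HT K (Gen m)) := Submodule.span K (bgen K m j k)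

/-- **THE BOX SIEGEL IDEAL `boxSiegelIdeal m k`** (all `n` factors): `span{E_t ∧ emb_i(s^{(i)}_{ab}) : |t| + 2 = k}` — the degree-`k` part of the
ideal of `⋀(K^{Σ 2m_i})` generated by gen 10's product Siegel space `SiegelBox = ⊕_i emb_i(Siegel_{m_i})`. -/
noncomputable def boxSiegelIdeal (k : ℕ) : Submodule K (HT K (Gen m)) := boxSI K m n k

/-- a generator lies in the box Siegel ideal. -/
lemma B_mul_bsgen_mem_boxSI {j k : ℕ} {t : Finset (Gen m)} (ht : t ⊆ pre m j) (hk : t.card + 2 = k) {x : Σ i : Fin n, SIdx (m i)}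
    (hx : ((x.1 : Fin n) : ℕ) < j) : B K (Gen m) t * bsgen K m x ∈ boxSI K m j k := Submodule.subset_span ⟨(t, x), ⟨ht, hk, hx⟩, rfl⟩

/-- a generator of the all-factor box Siegel ideal (no side conditions). -/
lemma B_mul_bsgen_mem_boxSiegelIdeal {k : ℕ} {t : Finset (Gen m)} (hk : t.card + 2 = k) (x : Σ i : Fin n, SIdx (m i)) :
    B K (Gen m) t * bsgen K m x ∈ boxSiegelIdeal K m k :=
  B_mul_bsgen_mem_boxSI K m (by rw [pre_top]; exact Finset.subset_univ t) hk x.1.2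

/-- the all-factor box Siegel ideal as a span without side conditions. -/
theorem boxSiegelIdeal_eq_span (k : ℕ) :
    boxSiegelIdeal K m k = Submodule.span K
      ((fun p : Finset (Gen m) × (Σ i : Fin n, SIdx (m i)) => B K (Gen m) p.1 * bsgen K m p.2) '' {p | p.1.card + 2 = k}) := by
  rw [boxSiegelIdeal, boxSI, bgen]
  congr 1
  ext v
  simp only [Set.mem_image, Set.mem_setOf_eq, pre_top, Finset.subset_univ, true_and]
  constructor
  · rintro ⟨p, ⟨hk, -⟩, rfl⟩; exact ⟨p, hk, rfl⟩
  · rintro ⟨p, hk, rfl⟩; exact ⟨p, ⟨hk, p.2.1.2⟩, rfl⟩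

/-- the box Siegel ideal is monotone in the number of factors. -/
lemma boxSI_mono {i j : ℕ} (hij : i ≤ j) (k : ℕ) : boxSI K m i k ≤ boxSI K m j k := by
  rw [boxSI, Submodule.span_le]
  rintro _ ⟨p, ⟨ht, hk, hx⟩, rfl⟩
  exact B_mul_bsgen_mem_boxSI K m (ht.trans (pre_mono m hij)) hk (by omega)

/-- with no factors the box Siegel ideal is zero. -/
lemma boxSI_zero (k : ℕ) : boxSI K m 0 k = ⊥ := by
  rw [boxSI, Submodule.span_eq_bot]
  rintro _ ⟨p, ⟨-, -, h⟩, rfl⟩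
  omega

/-- `boxSI j k ≤ Hom(pre j, k)`: the box Siegel ideal of the first `j` factors is homogeneous of degree `k` on the first `j` blocks. -/
theorem boxSI_le_Hom (j k : ℕ) : boxSI K m j k ≤ Hom K (Gen m) (pre m j) k := by
  rw [boxSI, Submodule.span_le]
  rintro _ ⟨⟨t, x⟩, ⟨ht, hk, hx⟩, rfl⟩
  have h := B_mul_mem_Hom K ht (Hom_mono K (blk_subset_pre m hx) 2 (bsgen_mem_Hom K m x))
  rwa [hk] at h

/-- `boxSiegelIdeal m k ≤ ⋀^k`. -/
theorem boxSiegelIdeal_le_exteriorPower (k : ℕ) : boxSiegelIdeal K m k ≤ ⋀[K]^k (Gen m → K) := by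
  rw [exteriorPower_eq_Hom_univ_gen, ← pre_top m]
  exact boxSI_le_Hom K m n k

/-- **in degree `2` the box Siegel ideal is gen 10's product Siegel space `SiegelBox`.** -/
theorem boxSiegelIdeal_two : boxSiegelIdeal K m 2 = siegelBox K m := by
  have hB : B K (Gen m) (∅ : Finset (Gen m)) = 1 := by
    rw [B, ExteriorAlgebra.basis_apply_ofCard (b K (Gen m)) Finset.card_empty]
    simp [ExteriorAlgebra.ιMulti_family]
  apply le_antisymm
  · rw [boxSiegelIdeal_eq_span, Submodule.span_le]
    rintro _ ⟨⟨t, x⟩, ht, rfl⟩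
    have ht0 : t = ∅ := Finset.card_eq_zero.mp (by simp only [Set.mem_setOf_eq] at ht; omega)
    subst ht0
    show B K (Gen m) ∅ * bsgen K m x ∈ _
    rw [hB, one_mul]
    exact Submodule.subset_span ⟨x, rfl⟩
  · rw [siegelBox, Submodule.span_le]
    rintro _ ⟨x, rfl⟩
    have h := B_mul_bsgen_mem_boxSiegelIdeal K m (t := ∅) (by rw [Finset.card_empty]) x
    rwa [hB, one_mul] at h

/-- **THE BOX SIEGEL IDEAL IS KILLED BY EVERY HANKEL BOX: `θ ∧ (v₀ ∧ ⋯ ∧ v_{n−1}) = 0` for `θ ∈ boxSI j k`, EVERY sequences `q_i`**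
(every field, every `n`, every dimensions; `E_t ∧ (emb_i(s_{ab}) ∧ F) = 0` by gen 10's `WedgeHankelBoxSiegel`). -/
theorem mul_hankelBox_eq_zero_of_mem_boxSI {j k : ℕ} {θ : HT K (Gen m)} (hθ : θ ∈ boxSI K m j k) (q : Fin n → ℕ → K) :
    θ * hankelBox K m q = 0 := by
  induction hθ using Submodule.span_induction with
  | mem x hx =>
    obtain ⟨p, -, rfl⟩ := hx
    rw [mul_assoc, mul_hankelBox_eq_zero_of_mem_siegelBox K m (Submodule.subset_span ⟨p.2, rfl⟩) q, mul_zero]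
  | zero => rw [zero_mul]
  | add x y _ _ hx hy => rw [add_mul, hx, hy, add_zero]
  | smul c x _ hx => rw [smul_mul_assoc, hx, smul_zero]

/-- **`boxSiegelIdeal m k ≤ ker(θ ↦ θ ∧ F ∣ ⋀^k)` for EVERY Hankel box `F`** (every field, `n`, dimensions `m_i`, classes `q_i`, degree `k`) —
a NAMED, `q`-independent part of the kernel in every degree (gen 10's `siegelBox_le_ker` is the degree-`2` case). -/
theorem boxSiegelIdeal_le_ker (k : ℕ) (q : Fin n → ℕ → K) :
    (boxSiegelIdeal K m k).comap (⋀[K]^k (Gen m → K)).subtype ≤ LinearMap.ker (wedge K (Gen m) k (hankelBox K m q)) := by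
  intro θ hθ
  rw [LinearMap.mem_ker, wedge, LinearMap.comp_apply, Submodule.subtype_apply, LinearMap.mulRight_apply]
  exact mul_hankelBox_eq_zero_of_mem_boxSI K m hθ q

/-- the comap along `⋀^k ↪ ⋀` does not change the dimension of the box Siegel ideal. -/
lemma finrank_comap_boxSiegelIdeal (k : ℕ) :
    finrank K ((boxSiegelIdeal K m k).comap (⋀[K]^k (Gen m → K)).subtype) = finrank K (boxSiegelIdeal K m k) :=
  (Submodule.comapSubtypeEquivOfLe (boxSiegelIdeal_le_exteriorPower K m k)).finrank_eq

/-- **A NAMED KERNEL FLOOR IN EVERY DEGREE: `dim ker(θ ↦ θ ∧ F ∣ ⋀^k) ≥ dim boxSiegelIdeal_k`** for every Hankel box (the number is computed in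
the sequel: `C(Σ 2m_i, k) − [t^k] Π_i G_{m_i}`). -/
theorem finrank_boxSiegelIdeal_le_finrank_ker (k : ℕ) (q : Fin n → ℕ → K) :
    finrank K (boxSiegelIdeal K m k) ≤ finrank K (LinearMap.ker (wedge K (Gen m) k (hankelBox K m q))) := by
  rw [← finrank_comap_boxSiegelIdeal]
  exact Submodule.finrank_mono (boxSiegelIdeal_le_ker K m k q)

/-! ## §4. The product inclusions (one more factor) -/

/-- **`boxSI_j^a ∧ Hom(block j, b) ≤ boxSI_{j+1}^{a+b}`**: `(E_t ∧ emb_i(s)) ∧ E_s' = ± E_{t ∪ s'} ∧ emb_i(s)` (the Siegel 2-vector is even). -/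
theorem boxSI_mul_Hom_le {j : ℕ} (hj : j < n) (a b : ℕ) :
    boxSI K m j a * Hom K (Gen m) (blk m j) b ≤ boxSI K m (j + 1) (a + b) := by
  rw [boxSI, Hom, Submodule.span_mul_span, Submodule.span_le]
  rintro _ ⟨_, ⟨⟨t, x⟩, ⟨ht, hk, hx⟩, rfl⟩, _, ⟨s, ⟨hs, hb⟩, rfl⟩, rfl⟩
  simp only at ht hk hx
  have hdisj : Disjoint t s := disjoint_of_subsets (disjoint_pre_blk m hj) ht hs
  show B K (Gen m) t * bsgen K m x * B K (Gen m) s ∈ _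
  rw [mul_assoc, ← B_mul_bsgen_comm, ← mul_assoc, B_mul_B, smul_mul_assoc]
  refine Submodule.smul_mem _ _ (B_mul_bsgen_mem_boxSI K m (x := x) ?_ ?_ (by omega))
  · rw [pre_succ]; exact union_subset_union' ht hs
  · rw [card_union_of_disjoint' hdisj, hb]; omega

/-- **`Hom(pre j, a) ∧ S_j^b ≤ boxSI_{j+1}^{a+b}`**: `E_t ∧ emb_j(E_{t'} ∧ s_{ab}) = ± E_{t ∪ emb_j t'} ∧ emb_j(s_{ab})`. -/
theorem Hom_mul_S_le {j : ℕ} (hj : j < n) (a b : ℕ) :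
    Hom K (Gen m) (pre m j) a * S K m ⟨j, hj⟩ b ≤ boxSI K m (j + 1) (a + b) := by
  rw [S, siegelIdeal, Submodule.map_span, Hom, Submodule.span_mul_span, Submodule.span_le]
  rintro _ ⟨_, ⟨t, ⟨ht, ha⟩, rfl⟩, _, ⟨_, ⟨p, rfl⟩, rfl⟩, rfl⟩
  have hs : p.1.1.map (facEmb m ⟨j, hj⟩).toEmbedding ⊆ blk m j := by
    rw [blk, dif_pos hj]; exact Finset.map_subset_map.mpr (Finset.subset_univ _)
  have hdisj : Disjoint t (p.1.1.map (facEmb m ⟨j, hj⟩).toEmbedding) := disjoint_of_subsets (disjoint_pre_blk m hj) ht hs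
  show B K (Gen m) t * (emb K (facEmb m ⟨j, hj⟩)).toLinearMap (igen K p) ∈ _
  rw [AlgHom.toLinearMap_apply, igen, map_mul, emb_B, ← mul_assoc, B_mul_B, smul_mul_assoc]
  refine Submodule.smul_mem _ _ (B_mul_bsgen_mem_boxSI K m (x := ⟨⟨j, hj⟩, p.2⟩) ?_ ?_ (show j < j + 1 by omega))
  · rw [pre_succ]; exact union_subset_union' ht hs
  · rw [card_union_of_disjoint' hdisj, Finset.card_map, ha]
    have := p.1.2
    omega

end Box
end Summit.Ventures.HSemireg.Wedge.HankelBoxSiegelIdeal
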